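import Summits.QuantumFields.YangMills.Theorems.ColdBoxAllGroupsOneScaleDefs
import Mathlib.MeasureTheory.Measure.Tilted
import Mathlib.Probability.ConditionalProbability
import HarnessLib

/-!
# LINE-17 «hypercontractive second-order tilt expansion» on crux `AllWindowsColdBox.BoxMidWindowsSU22` (stmt-QuantumFields-24003):
# the FIXED DATA of the line and its three remaining obligation Props (E, F, G-conclusion), verbatim from the registered skeleton
# (planner ym-idea-2 g14, skeleton v3, sha16 `4747b363e792659d`, §«Fixed data of the line» and §«The seven obligation Props»)

The registered stubs E `stub_tiltMoments`, F `stub_gaussSideTerms`, G `stub_coreBound` of LINE-17 are stated over objects that the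
skeleton DEFINES (they are not in the tree): the group/representation `SU2`/`ρ₂`, the exponent `epsOf θ = 17θ/8`, the link radius
`etaOf`, the conditioning event `lineEvent`, the reference measure `lineGauss = gaussD[|lineEvent]`, `AdmissibleDensity`, the centred tilt
`centredTilt`, the observables `obsF`/`obsG`, and the Props `TiltMoments θ`, `GaussSideTerms θ`, `CoreBound θ`.  This file copies them
VERBATIM (same names, same bodies) into the shared namespace `…Theorems.AllWindowsColdBoxBoxMidLine`, so that the provers of E, F, G
work against ONE tree copy and their by-name files `theorem stub_… : <Prop>` agree literally with the registered signatures.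
Obligations A–D of the line are already tree theorems (`…AllWindowsColdBoxTiltedCov.stub_tiltedCovSecondOrder`,
`…AllWindowsColdBox.GaussHypercontractivity.stub_gaussPolyHypercontractivity`, `…AllWindowsColdBoxDirFreeVar.stub_dirFreeVarLinear`,
`…AllWindowsColdBox.DirPoincare.stub_dirPoincareCubic`).  Definitions only; nothing is proved here.

HONEST LABEL: bookkeeping for ONE critic-PASSed line on the R2ξ″ RECORD-rung crux 24003; no crux, rung or summit is proved; the
Yang–Mills mass gap is NOT proved by this file.
-/

set_option autoImplicit false

noncomputable section

open MeasureTheory ProbabilityTheory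
open Literature.MathematicalPhysics.QuantumLattice
open Literature.MathematicalPhysics.QuantumFieldTheory
open Literature.MathematicalPhysics.QuantumFieldTheory.LatticeMaxwell
open Summit.QuantumFields.YangMills.Theorems.WeakCouplingRates
open Summit.QuantumFields.YangMills.Theorems.ColdBoxAllGroups
open Summit.QuantumFields.YangMills.Theorems.FreeEnergyLogCoefficient

namespace Summit.QuantumFields.YangMills.Theorems.AllWindowsColdBoxBoxMidLine

/-! ## Fixed data of the line (verbatim from the skeleton) -/

/-- The gauge group of the crux: `SU(2)`. (LINE-17 skeleton v3, verbatim.) -/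
abbrev SU2 : Type := Matrix.specialUnitaryGroup (Fin 2) ℂ

/-- Its fundamental representation (the `ρ` of `boxPlaqCov` in the crux). (LINE-17 skeleton v3, verbatim.) -/
abbrev ρ₂ : SU2 →* Matrix (Fin 2) (Fin 2) ℂ := fundamentalRep (Fin 2)

/-- The small-field exponent of the line, `ε = 17θ/8`. (LINE-17 skeleton v3, verbatim.) -/
def epsOf (θ : ℝ) : ℝ := 17 * θ / 8

/-- The link radius scale `η = (12H²+2H+1)·√2·√(β^{2ε−1})` of the tree's representation; the conditioning ball has radius `2η`.
(LINE-17 skeleton v3, verbatim.) -/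
def etaOf (β : ℝ) (H : ℕ) (ε : ℝ) : ℝ := (12 * (H : ℝ) ^ 2 + 2 * H + 1) * (Real.sqrt 2 * Real.sqrt (β ^ (2 * ε - 1)))

/-- The conditioning event `E_β = goodTE ∩ {all unscaled link coordinates ≤ 2η}` in the colour variables, `H = ⌈β^θ⌉₊`, `D = dimE ρ₂` —
exactly the event of the tree's representation B4′. (LINE-17 skeleton v3, verbatim.) -/
def lineEvent (θ β : ℝ) : Set (TSpaceD ⌈β ^ θ⌉₊ (dimE ρ₂)) :=
  goodTE ρ₂ ⌈β ^ θ⌉₊ β (epsOf θ) ∩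
    {t | ∀ e, ‖unscaleTE ⌈β ^ θ⌉₊ (dimE ρ₂) β t e‖ ≤ 2 * etaOf β ⌈β ^ θ⌉₊ (epsOf θ)}

/-- The reference measure of the expansion: the Dirichlet Gaussian `gaussD = boxDirichlet^{⊗D}` conditioned on `E_β`.
(LINE-17 skeleton v3, verbatim.) -/
def lineGauss (θ β : ℝ) : Measure (TSpaceD ⌈β ^ θ⌉₊ (dimE ρ₂)) :=
  (gaussD ⌈β ^ θ⌉₊ (dimE ρ₂))[|lineEvent θ β]

/-- Admissible chart densities (the shape of the output of the tree's B5-J `exists_chartMeasureE_restrict_closedBall_eq_withDensity`).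
(LINE-17 skeleton v3, verbatim.) -/
def AdmissibleDensity (r₂ C₂ : ℝ) (J : EuclideanSpace ℝ (Fin (dimE ρ₂)) → ℝ) : Prop :=
  0 < r₂ ∧ 0 < C₂ ∧ Continuous J ∧ (∀ a, ‖a‖ ≤ r₂ → |J a - 1| ≤ C₂ * ‖a‖ ^ 2) ∧
    (∀ a, ‖a‖ ≤ r₂ → 1 / 2 ≤ J a ∧ J a ≤ 3 / 2)

/-- The CENTRED tilt `W_β = tiltWE − E_ν[tiltWE]` (`ν = lineGauss θ β`). (LINE-17 skeleton v3, verbatim.) -/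
def centredTilt (θ β : ℝ) (J : EuclideanSpace ℝ (Fin (dimE ρ₂)) → ℝ) (t : TSpaceD ⌈β ^ θ⌉₊ (dimE ρ₂)) : ℝ :=
  tiltWE ρ₂ ⌈β ^ θ⌉₊ J β t - ∫ s, tiltWE ρ₂ ⌈β ^ θ⌉₊ J β s ∂(lineGauss θ β)

/-- The first observable read in the chart: `β · cost` of the central `(1,2)`-plaquette. (LINE-17 skeleton v3, verbatim.) -/
def obsF (θ β : ℝ) (t : TSpaceD ⌈β ^ θ⌉₊ (dimE ρ₂)) : ℝ :=
  β * plaqCostAt ρ₂ (boxCentre ⌈β ^ θ⌉₊) 1 2 (cfgTE ρ₂ ⌈β ^ θ⌉₊ β t)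

/-- The second observable: `β · cost` of the `(1,2)`-plaquette translated by `T e₀`. (LINE-17 skeleton v3, verbatim.) -/
def obsG (θ β : ℝ) (T : ℕ) (t : TSpaceD ⌈β ^ θ⌉₊ (dimE ρ₂)) : ℝ :=
  β * plaqCostAt ρ₂ (boxCentre ⌈β ^ θ⌉₊ + Pi.single 0 (T : ℤ)) 1 2 (cfgTE ρ₂ ⌈β ^ θ⌉₊ β t)

/-! ## The three remaining obligation Props of the line (verbatim from the skeleton) -/

/-- **Obligation E, conclusion: the hypercontractive moments of the centred tilt** at box exponent `θ` — for every admissible chart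
density, eventually in `β`, `‖W‖₈² ≤ K·⌈β^θ⌉⁶/β` and `∫ e^{4|W|} dν ≤ 4` (`ν = lineGauss`, `W = centredTilt`). (LINE-17 skeleton v3, verbatim;
registered stub `stub_tiltMoments : GaussPolyHypercontractivity → DirFreeVarLinear → DirPoincareCubic → ∀ θ, 0 < θ → θ ≤ 1/16 → TiltMoments θ`.) -/
def TiltMoments (θ : ℝ) : Prop :=
  ∀ (r₂ C₂ : ℝ) (J : EuclideanSpace ℝ (Fin (dimE ρ₂)) → ℝ), AdmissibleDensity r₂ C₂ J →
    ∃ K β₀ : ℝ, 0 ≤ K ∧ ∀ β : ℝ, β₀ ≤ β →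
      (∫ t, centredTilt θ β J t ^ 8 ∂(lineGauss θ β)) ^ (1 / 4 : ℝ) ≤ K * (⌈β ^ θ⌉₊ : ℝ) ^ 6 / β ∧
        ∫ t, Real.exp (4 * |centredTilt θ β J t|) ∂(lineGauss θ β) ≤ 4

/-- **Obligation F, conclusion: the Gaussian-side terms** at box exponent `θ`, for all `T ≤ ⌈β^θ⌉`, eventually in `β`: (i) fourth moments
of the centred observables `≤ K`; (ii) `|Cov_ν(f,g) − ¾·boxDirCircSqCov ⌈β^θ⌉ T| ≤ K⌈β^θ⌉⁶/β`; (iii) the first-order tilt term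
`|∫ f̃ g̃ W dν| ≤ K⌈β^θ⌉⁶/β`. (LINE-17 skeleton v3, verbatim; registered stub
`stub_gaussSideTerms : DirFreeVarLinear → DirPoincareCubic → ∀ θ, 0 < θ → θ ≤ 1/16 → GaussSideTerms θ`.) -/
def GaussSideTerms (θ : ℝ) : Prop :=
  ∀ (r₂ C₂ : ℝ) (J : EuclideanSpace ℝ (Fin (dimE ρ₂)) → ℝ), AdmissibleDensity r₂ C₂ J →
    ∃ K β₀ : ℝ, 0 ≤ K ∧ ∀ β : ℝ, β₀ ≤ β → ∀ T : ℕ, T ≤ ⌈β ^ θ⌉₊ →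
      (∫ t, (obsF θ β t - ∫ s, obsF θ β s ∂(lineGauss θ β)) ^ 4 ∂(lineGauss θ β)) ^ (1 / 4 : ℝ) ≤ K ∧
      (∫ t, (obsG θ β T t - ∫ s, obsG θ β T s ∂(lineGauss θ β)) ^ 4 ∂(lineGauss θ β)) ^ (1 / 4 : ℝ) ≤ K ∧
      |((∫ t, obsF θ β t * obsG θ β T t ∂(lineGauss θ β)) -
          (∫ t, obsF θ β t ∂(lineGauss θ β)) * (∫ t, obsG θ β T t ∂(lineGauss θ β))) -
        3 / 4 * boxDirCircSqCov ⌈β ^ θ⌉₊ T| ≤ K * (⌈β ^ θ⌉₊ : ℝ) ^ 6 / β ∧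
      |∫ t, (obsF θ β t - ∫ s, obsF θ β s ∂(lineGauss θ β)) * (obsG θ β T t - ∫ s, obsG θ β T s ∂(lineGauss θ β)) *
          centredTilt θ β J t ∂(lineGauss θ β)| ≤ K * (⌈β ^ θ⌉₊ : ℝ) ^ 6 / β

/-- **The core bound** at box exponent `θ` (conclusion of obligation G): the absolute Dirichlet comparison with the explicit ONE-SCALE
rate `K·⌈β^θ⌉⁶/β`, uniformly in `T ≤ ⌈β^θ⌉`. (LINE-17 skeleton v3, verbatim; registered stub
`stub_coreBound : TiltedCovSecondOrder → ∀ θ, 0 < θ → θ ≤ 1/16 → TiltMoments θ → GaussSideTerms θ → CoreBound θ`.) -/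
def CoreBound (θ : ℝ) : Prop :=
  ∃ K β₀ : ℝ, 0 ≤ K ∧ ∀ β : ℝ, β₀ ≤ β → ∀ T : ℕ, T ≤ ⌈β ^ θ⌉₊ →
    |β ^ 2 * boxPlaqCov ρ₂ β ⌈β ^ θ⌉₊ T - 3 / 4 * boxDirCircSqCov ⌈β ^ θ⌉₊ T| ≤ K * (⌈β ^ θ⌉₊ : ℝ) ^ 6 / β

end Summit.QuantumFields.YangMills.Theorems.AllWindowsColdBoxBoxMidLine

end
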